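/-
Copyright (c) 2026 the pub-hodgecm-mathlib formalisation cell (harness21).  Prover seat hodgecm-mathlib-F0P3-p02 (g16), 2026-09-01.  Road «S3-ram» seeding wave (LEAD F0P3a-plan (g12) T11-41∕T11-54∕T11-57∕T11-74;
owner F0P3a-p06 (g15)), row «(L)-ram» file L5-E: the (e3) LEVI clause of the fold's `stub_levelOneRowsRam` :118 with BOTH sockets discharged (★ F0P3a-p01 (g15) `…_of_frame_of_integral_eq` ∘ ★ FILE L5-D).
-/
import Literature.NumberTheory.Rogawski1990.DepthZeroKappaTransferLeviRamifiedOfFrame    -- ★ (F0P3a-p01 (g15)): (e3) with the C-Δ Levi value discharged, socket `hN` — `finsum_delta_mul_classOrbitalIntegral_eq_of_levi_ramified_levelOne_of_frame_of_integral_eq`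
import Literature.NumberTheory.Rogawski1990.LevelOnePieceAverageSocketRamified            -- ★ FILE L5-D (this seat): `exists_integral_comp_symm_eq_mul_of_levelOne_ramified` (the `hN` socket, `∃ X`)
import HarnessLib

/-!
# (e3) THE LEVI ROW OF THE DEPTH-ZERO Δ‴-TRANSFER AT A TAME-RAMIFIED PLACE FOR A `v`-LEVEL-ONE `K`-CLASS PIECE — SOCKET-FREE
(Rogawski (1990) §4.9 Prop. 4.9.1 pp. 54–56, §12.2 p. 173)

Topic `NumberTheory/Rogawski1990`; namespace `Literature.NumberTheory.Rogawski1990`.  KERNEL mathematics only: one theorem, no definition, no named fact, no instance, no notation,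
no `sorry`.  Cell `pub/hodgecm-mathlib`, crux H413 = `stmt-HodgeConjecture-24833`; road «S3-ram» seeding wave (LEAD F0P3a-plan (g12); owner F0P3a-p06 (g15)), row **«(L)-ram», FILE L5-E**
(seat F0P3-p02 (g16)) = the TIE of the (e3) organ (F0P3a-p01 (g15): ★ p846921 → ★ `DepthZeroKappaTransferLeviRamifiedOfFrame`, C-Δ value ★ p846910 p07 (g12)) with the (U)-ram head
(F0P2-p01 (g15), F0P3a-p05 (g16)) and the (L)-ram `N ∩ K₃`-average (this seat, ★ FILES L1–L5-D).  CONSUMER: END F0P3a-p03 (g16)'s fold v6 `stub_levelOneRowsRam` :118, Levi population.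
HONEST LABEL: HC_CM is proved only modulo the 2 remaining named inputs (hLiu418 24832, h413 24833) until rung 0 closes; «S3-ram» is Literature seeding; this file discharges no named fact.

THE MATHEMATICS.  ★ `finsum_delta_mul_classOrbitalIntegral_eq_of_levi_ramified_levelOne_of_frame_of_integral_eq` proves the Levi row
`Σᶠ_c Δ‴(γ_H, c)·Φ(c, g) = a₀·Φ^st(γ_H, 1_{K_H}·χ₀) + a₁·Φ^st(γ_H, 1_{K_H}·χ₁)` near `γ_H = 1` on the Levi population, for ANY `a₁` and for `a₀` passing the test
`a₀·ν_H(K_H) = (y_λ, θ)_v·ν_G(K′)·X`, GIVEN the socket `hN : ∫_N g(ψ⁻¹ n) dμ_N = μ_N(N ∩ K₃)·X` for every level frame.  ★ FILE L5-D supplies `∃ X, hN` for every `v`-level-one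
`K`-class piece supported in `K′`; `ν_H(K_H) ≠ 0` (compact open), so `a₀ := (y_λ, θ)_v·ν_G(K′)·X ∕ ν_H(K_H)` passes the test.  Hence **the Levi row holds with NO socket:
`∃ a₀, ∀ a₁, ∃ V ∈ 𝓝 1, ∀ γ_H ∈ V` regular of Levi type, the identity** (`exists_finsum_delta_mul_classOrbitalIntegral_eq_of_levi_ramified_levelOne_of_frame`).

## References
* [Rogawski1990] J. D. Rogawski, *Automorphic Representations of Unitary Groups in Three Variables*, Ann. of Math. Stud. 123 (1990), §4.9 Prop. 4.9.1 (a)(b) pp. 54–56; §4.3 (4.3.1) p. 43; §12.2 p. 173.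
* [LanglandsShelstad1987] R. P. Langlands, D. Shelstad, *On the definition of transfer factors*, Math. Ann. 278 (1987), §1.3–1.4.
* [Kottwitz1986] R. E. Kottwitz, *Base change for unit elements of Hecke algebras*, Compositio Math. 60 (1986), §3.
-/

set_option autoImplicit false

noncomputable section

open MeasureTheory Measure Set Filter Topology NumberField IsDedekindDomain Matrix ValuativeRel
open scoped ENNReal NNReal Matrix MatrixGroups ValuativeRel WithZero

namespace Literature.NumberTheory.Rogawski1990

open Literature.NumberTheory.Automorphic Literature.NumberTheory.Automorphic.UnitaryGroup Literature.NumberTheory.Automorphic.IntegralReduction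
open Literature.NumberTheory.GaloisRepresentations Literature.NumberTheory.GaloisRepresentations.IsNonarchimedeanLocalField
open Literature.NumberTheory.QuadraticForms

set_option maxHeartbeats 1600000 in
-- instance-term unification on the CM local carriers (as in ★ p846921 ∕ ★ `DepthZeroKappaTransferLeviRamifiedOfFrame`)
open scoped Classical in
/-- **(e3) THE LEVI ROW AT A TAME-RAMIFIED PLACE FOR A LEFT-`K(ϖ_v)`-INVARIANT `K`-CLASS PIECE — SOCKET-FREE** (★ `…_of_frame_of_integral_eq` ∘ ★ FILE L5-D
`exists_integral_comp_symm_eq_mul_of_levelOne_ramified`): binders = END fold v6 `stub_levelOneRowsRam` :118 (`hH' w hw he hH'w hH'i h2`, block `ϖ hϖ hσϖ`, frame `A hA hframe`, measures and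
canonical orbital families, piece `g hgm hgK hginv hg1`) + the C-Δ guard `hμω`, `y_λ` with `ι_w y_λ = −det H′_w` (★ p846910).  Conclusion: **`∃ a₀, ∀ a₁, ∃ V ∈ 𝓝 1, ∀ γ_H ∈ V`
`G`-regular of Levi type, `Σᶠ_c Δ‴(γ_H, c)·Φ(c, g) = a₀·Φ^st(γ_H, 1_{K_H}χ₀) + a₁·Φ^st(γ_H, 1_{K_H}χ₁)`** (`a₀ = (y_λ, θ)_v·ν_G(K′)·X∕ν_H(K_H)`, `X` the `N ∩ K₃`-average of ★ FILE L5-D).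
[cite: Rogawski1990, §4.9 Prop. 4.9.1 (a)(b) pp. 54–56; §4.3 (4.3.1) p. 43] [cite: LanglandsShelstad1987, §1.3–1.4] [cite: Kottwitz1986, §3] -/
theorem exists_finsum_delta_mul_classOrbitalIntegral_eq_of_levi_ramified_levelOne_of_frame
    (L : Type) [Field L] [NumberField L] [IsCMField L] (H' : Matrix (Fin 3) (Fin 3) L) (μ : HeckeCharacter L)
    {v : HeightOneSpectrum (𝓞 ↥(maximalRealSubfield L))}
    (hH' : (H'.map (cmConjRingHom L)).transpose = H') (w : PlacesOver L v)
    (hw : IsCMField.complexConj L • w.1 = w.1) (he : v.asIdeal.ramificationIdx' w.1.asIdeal ≠ 1)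
    (hH'w : IsUnit (placeForm H' w.1)) (hH'i : hH'w.unit ∈ glInt 3 (w.1.adicCompletion L))
    (h2 : IsUnit (2 : 𝒪[w.1.adicCompletion L]))
    -- the tame-ramified block (fold v6 binders): `ϖ ∈ L_w`, `|ϖ| = exp(−1)`, `σ_w ϖ = −ϖ`
    (ϖ : (w.1.adicCompletion L)) (hϖ : Valued.v ϖ = WithZero.exp (-1 : ℤ)) (hσϖ : galAdicCompletionMap (L := L) (IsCMField.complexConj L) hw ϖ = -ϖ)
    -- the integral antidiagonal FRAME of `H′_w` (END fold v2 socket binders; supplied at a tame-ramified `w` by ★ p846344 `exists_glInt_placeForm_eq_smul_formCongr_antidiagonal_of_neg`)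
    (A : GL (Fin 3) (w.1.adicCompletion L)) (hA : A ∈ glInt 3 (w.1.adicCompletion L))
    (hframe : placeForm H' w.1 = (-(placeForm H' w.1).det) • formCongr (galAdicCompletionMap (L := L) (IsCMField.complexConj L) hw) A ((StdForm.antidiagonal 3).over (w.1.adicCompletion L)))
    [MeasurableSpace ((cmDatum L 3 H').Local v)] [BorelSpace ((cmDatum L 3 H').Local v)]
    [∀ γ : ((cmDatum L 3 H').Local v), MeasurableSpace (((cmDatum L 3 H').Local v) ⧸ Subgroup.centralizer ({γ} : Set ((cmDatum L 3 H').Local v)))]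
    [∀ γ : ((cmDatum L 3 H').Local v), BorelSpace (((cmDatum L 3 H').Local v) ⧸ Subgroup.centralizer ({γ} : Set ((cmDatum L 3 H').Local v)))]
    [MeasurableSpace ((cmDatum L 2 (Matrix.of fun i j : Fin 2 => if i.val + j.val + 1 = 2 then (1 : L) else 0)).Local v ×
      (cmDatum L 1 (Matrix.of fun i j : Fin 1 => if i.val + j.val + 1 = 1 then (1 : L) else 0)).Local v)]
    [BorelSpace ((cmDatum L 2 (Matrix.of fun i j : Fin 2 => if i.val + j.val + 1 = 2 then (1 : L) else 0)).Local v ×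
      (cmDatum L 1 (Matrix.of fun i j : Fin 1 => if i.val + j.val + 1 = 1 then (1 : L) else 0)).Local v)]
    [∀ a : ((cmDatum L 2 (Matrix.of fun i j : Fin 2 => if i.val + j.val + 1 = 2 then (1 : L) else 0)).Local v ×
      (cmDatum L 1 (Matrix.of fun i j : Fin 1 => if i.val + j.val + 1 = 1 then (1 : L) else 0)).Local v),
      MeasurableSpace (((cmDatum L 2 (Matrix.of fun i j : Fin 2 => if i.val + j.val + 1 = 2 then (1 : L) else 0)).Local v ×
      (cmDatum L 1 (Matrix.of fun i j : Fin 1 => if i.val + j.val + 1 = 1 then (1 : L) else 0)).Local v) ⧸ Subgroup.centralizer ({a} : Set ((cmDatum L 2 (Matrix.of fun i j : Fin 2 => if i.val + j.val + 1 = 2 then (1 : L) else 0)).Local v ×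
      (cmDatum L 1 (Matrix.of fun i j : Fin 1 => if i.val + j.val + 1 = 1 then (1 : L) else 0)).Local v)))]
    [∀ a : ((cmDatum L 2 (Matrix.of fun i j : Fin 2 => if i.val + j.val + 1 = 2 then (1 : L) else 0)).Local v ×
      (cmDatum L 1 (Matrix.of fun i j : Fin 1 => if i.val + j.val + 1 = 1 then (1 : L) else 0)).Local v),
      BorelSpace (((cmDatum L 2 (Matrix.of fun i j : Fin 2 => if i.val + j.val + 1 = 2 then (1 : L) else 0)).Local v ×
      (cmDatum L 1 (Matrix.of fun i j : Fin 1 => if i.val + j.val + 1 = 1 then (1 : L) else 0)).Local v) ⧸ Subgroup.centralizer ({a} : Set ((cmDatum L 2 (Matrix.of fun i j : Fin 2 => if i.val + j.val + 1 = 2 then (1 : L) else 0)).Local v ×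
      (cmDatum L 1 (Matrix.of fun i j : Fin 1 => if i.val + j.val + 1 = 1 then (1 : L) else 0)).Local v)))]
    (νH : Measure ((cmDatum L 2 (Matrix.of fun i j : Fin 2 => if i.val + j.val + 1 = 2 then (1 : L) else 0)).Local v ×
      (cmDatum L 1 (Matrix.of fun i j : Fin 1 => if i.val + j.val + 1 = 1 then (1 : L) else 0)).Local v)) [νH.IsHaarMeasure] [νH.IsMulRightInvariant]
    (νG : Measure ((cmDatum L 3 H').Local v)) [νG.IsHaarMeasure] [νG.IsMulRightInvariant]
    {mH : OrbitalMeasureFamily ((cmDatum L 2 (Matrix.of fun i j : Fin 2 => if i.val + j.val + 1 = 2 then (1 : L) else 0)).Local v ×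
      (cmDatum L 1 (Matrix.of fun i j : Fin 1 => if i.val + j.val + 1 = 1 then (1 : L) else 0)).Local v)} {mG : OrbitalMeasureFamily ((cmDatum L 3 H').Local v)}
    (hmH : mH.IsCanonical (IsLocalGRegular L v) νH)
    (hmG : mG.IsCanonical (fun γ => IsRegularElt (γ.val : GL (Fin 3) (UnitaryGroup.LocalRing L v))) νG)
    -- the piece: Borel, `Ad K′`-invariant, LEFT-INVARIANT under the `v`-level-1 congruence set `K(ϖ_v)` (END fold v6 `stub_levelOneRowsRam` :118 token `hg1` VERBATIM)
    (g : ((cmDatum L 3 H').Local v) → ℂ) (hgm : Measurable g)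
    (hgK : tsupport g ⊆ (cmLocalIntegralLevel L 3 H' v : Set ((cmDatum L 3 H').Local v)))
    (hginv : ∀ u ∈ cmLocalIntegralLevel L 3 H' v, ∀ x, g (u * x * u⁻¹) = g x)
    (hg1 : ∀ u : (cmDatum L 3 H').Local v,
      (∀ a b, Valued.v (((toPlace v w (HeckeCharacter.uniformizer ↥(maximalRealSubfield L) v : v.adicCompletion ↥(maximalRealSubfield L))) ^ 1)⁻¹ *
        ((((localNonsplitEquiv (IsCMField.complexConj L) H' (IsCMField.complexConj_ne_one L) w hw u :
            ↥(unitaryGroupOfForm (galAdicCompletionMap (L := L) (IsCMField.complexConj L) hw) (placeForm H' w.1))) : GL (Fin 3) (w.1.adicCompletion L)) :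
              Matrix (Fin 3) (Fin 3) (w.1.adicCompletion L)) a b - (1 : Matrix (Fin 3) (Fin 3) (w.1.adicCompletion L)) a b)) ≤ 1) →
      ∀ x, g (u * x) = g x)
    (hμω : ∀ x : ideleGroup ↥(maximalRealSubfield L), μ (AdeleRing.ideleBaseChange ↥(maximalRealSubfield L) L x) = quadraticHeckeCharCM L x)
    (yl : v.adicCompletion ↥(maximalRealSubfield L)) (hyl : toPlace v w yl = -(placeForm H' w.1).det) :
    ∃ a₀ : ℂ, ∀ a₁ : ℂ,
        ∃ V ∈ 𝓝 (1 : ((cmDatum L 2 (Matrix.of fun i j : Fin 2 => if i.val + j.val + 1 = 2 then (1 : L) else 0)).Local v ×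
        (cmDatum L 1 (Matrix.of fun i j : Fin 1 => if i.val + j.val + 1 = 1 then (1 : L) else 0)).Local v)),
      ∀ γH ∈ V, IsLocalGRegular L v γH →
        (∃ (y : ((cmDatum L 2 (Matrix.of fun i j : Fin 2 => if i.val + j.val + 1 = 2 then (1 : L) else 0)).Local v ×
        (cmDatum L 1 (Matrix.of fun i j : Fin 1 => if i.val + j.val + 1 = 1 then (1 : L) else 0)).Local v)) (d' : Fin 2 → (UnitaryGroup.LocalRing L v)ˣ),
          glDiagonal 2 (UnitaryGroup.LocalRing L v) d' = ((y * γH * y⁻¹).1.val : GL (Fin 2) (UnitaryGroup.LocalRing L v))) →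
        ∑ᶠ cG : ConjClasses ((cmDatum L 3 H').Local v),
            ((finExplicitCollection L H' μ (finExplicitDelta_conj_left_all L H' μ) (finExplicitDelta_conj_right_all L H' μ)) v).Δ γH (Quotient.out cG) *
              classOrbitalIntegral mG g cG =
          a₀ * stableOrbitalIntegralRel (IsLocalStablyConjH L v) mH
                ((((cmLocalIntegralLevel L 2 (Matrix.of fun i j : Fin 2 => if i.val + j.val + 1 = 2 then (1 : L) else 0) v).prod
                (cmLocalIntegralLevel L 1 (Matrix.of fun i j : Fin 1 => if i.val + j.val + 1 = 1 then (1 : L) else 0) v) : Subgroup _) : Set _).indicator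
              (fun h => if (redMat (((h.1.val : GL (Fin 2) (UnitaryGroup.LocalRing L v)).val.map (Pi.evalRingHom (fun w' : PlacesOver L v => w'.1.adicCompletion L) w))) - 1) ^ 2 = 0 ∧ (redMat (((h.1.val : GL (Fin 2) (UnitaryGroup.LocalRing L v)).val.map (Pi.evalRingHom (fun w' : PlacesOver L v => w'.1.adicCompletion L) w))) - 1).rank = 0 then (1 : ℂ) else 0)) γH +
          a₁ * stableOrbitalIntegralRel (IsLocalStablyConjH L v) mH
                ((((cmLocalIntegralLevel L 2 (Matrix.of fun i j : Fin 2 => if i.val + j.val + 1 = 2 then (1 : L) else 0) v).prod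
                (cmLocalIntegralLevel L 1 (Matrix.of fun i j : Fin 1 => if i.val + j.val + 1 = 1 then (1 : L) else 0) v) : Subgroup _) : Set _).indicator
              (fun h => if (redMat (((h.1.val : GL (Fin 2) (UnitaryGroup.LocalRing L v)).val.map (Pi.evalRingHom (fun w' : PlacesOver L v => w'.1.adicCompletion L) w))) - 1) ^ 2 = 0 ∧ (redMat (((h.1.val : GL (Fin 2) (UnitaryGroup.LocalRing L v)).val.map (Pi.evalRingHom (fun w' : PlacesOver L v => w'.1.adicCompletion L) w))) - 1).rank = 1 then (1 : ℂ) else 0)) γH := by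
  obtain ⟨X, hN⟩ := exists_integral_comp_symm_eq_mul_of_levelOne_ramified L H' hH' w hw he hH'w hH'i h2 ϖ hϖ hσϖ A hA hframe g hginv hg1 hgK
  -- `ν_H(K_H) ≠ 0`: `K_H` is compact open
  have hKH : (νH.real (((cmLocalIntegralLevel L 2 (Matrix.of fun i j : Fin 2 => if i.val + j.val + 1 = 2 then (1 : L) else 0) v).prod
                (cmLocalIntegralLevel L 1 (Matrix.of fun i j : Fin 1 => if i.val + j.val + 1 = 1 then (1 : L) else 0) v) : Subgroup _) : Set _) : ℂ) ≠ 0 := by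
    have hco := isCompact_isOpen_cmLocalIntegralLevel_prod L 2 1 (Matrix.of fun i j : Fin 2 => if i.val + j.val + 1 = 2 then (1 : L) else 0)
      (Matrix.of fun i j : Fin 1 => if i.val + j.val + 1 = 1 then (1 : L) else 0) v
    have hpos := hco.2.measure_pos νH ⟨1, Subgroup.one_mem _⟩
    have hfin := hco.1.measure_lt_top (μ := νH)
    exact_mod_cast (ENNReal.toReal_pos hpos.ne' hfin.ne).ne'
  refine ⟨(hilbertSymbol (v.adicCompletion ↥(maximalRealSubfield L)) yl
        (algebraMap ↥(maximalRealSubfield L) _ ((cmQuadraticGenerator L : 𝓞 ↥(maximalRealSubfield L)) : ↥(maximalRealSubfield L))) : ℂ) *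
      (νG.real (cmLocalIntegralLevel L 3 H' v : Set ((cmDatum L 3 H').Local v)) : ℂ) * X / (νH.real (((cmLocalIntegralLevel L 2 (Matrix.of fun i j : Fin 2 => if i.val + j.val + 1 = 2 then (1 : L) else 0) v).prod
                (cmLocalIntegralLevel L 1 (Matrix.of fun i j : Fin 1 => if i.val + j.val + 1 = 1 then (1 : L) else 0) v) : Subgroup _) : Set _) : ℂ), fun a₁ => ?_⟩
  exact finsum_delta_mul_classOrbitalIntegral_eq_of_levi_ramified_levelOne_of_frame_of_integral_eq L H' μ hH' w hw he hH'w hH'i h2 A hA hframe νH νG hmH hmG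
    g hgm hginv hg1 X _ a₁ hN hμω yl hyl (by rw [div_mul_cancel₀ _ hKH])

end Literature.NumberTheory.Rogawski1990

end
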